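import Mathlib.LinearAlgebra.Eigenspace.Pi
import Mathlib.GroupTheory.Index
import Mathlib.Data.ZMod.Basic
import Literature.NumberTheory.EllipticCurves.PastenSpectralDegree
import Literature.NumberTheory.EllipticCurves.PastenCongruenceModulusProofs
import Literature.NumberTheory.EllipticCurves.CongruenceNumber
import Literature.NumberTheory.EllipticCurves.NewformsMultiplicityOneProofs
import Literature.NumberTheory.EllipticCurves.NewformsSpanProofs
import HarnessLib

/-!
# Pasten's Thm. 5.5 for `X₀(N)`: the congruence number divides `∏ η_{[χ₀]}([χ])`, and the
# reduction of `PastenShimura2024_thm_5_5` to Ribet's theorem `m_E ∣ r_E` (proofs)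

Topic `NumberTheory/EllipticCurves`; a proofs-only companion (theorems only: no definition, no
named fact, nothing restated; D-0026) of `PastenSpectralDegree.lean`, written by the seat of its
named fact `PastenShimura2024_thm_5_5` — H. Pasten, *Shimura curves and the abc conjecture*,
J. Number Theory 254 (2024) = arXiv:1705.09251, Thm. 5.5 (p. 18; = Thm. 1.8), case `D = 1`,
`M = N`: *"The `(D,M)`-modular degree `δ` divides `∏_{[χ] ≠ [χ₀]} η_{[χ₀]}([χ])`."* Source read:
arXiv version, §4.9–4.11 (p. 16), §5.4–5.6 (pp. 17–19: Prop. 5.4, Thm. 5.5, first proof §5.5,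
second proof §5.6 with Lemma 5.6).

## The printed proof and this file

Pasten's **second proof** (§5.6, p. 19). For each class `c ≠ [χ₀]` choose `t_c ∈ 𝕀_c` with
`t_c f = η_{[χ₀]}(c) f`, and put `ϖ = ∏_{c ≠ [χ₀]} t_c ∈ 𝕋_{D,M} ⊆ 𝔼 = End(J₀^D(M))`. Under
`ψ : 𝕋 ↪ ∏_c R_c`, `ψ(ϖ)` is `R = ∏_{c ≠ [χ₀]} η_{[χ₀]}(c)` in the `[χ₀]`-component and `0`
elsewhere, so `ϖ = R · π₀` with `π₀` the Petersson-orthogonal projector onto `V^{χ₀} = ℂ f`;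
and **Lemma 5.6** ([CoKa], [ARSdeg] for `X₀(N)`): `δ` is the denominator of `π₀` with respect to
`𝔼^{op}`, i.e. `m π₀ ∈ 𝔼 ⇒ δ ∣ m`. Hence `δ ∣ R`.

The tree has no Jacobian `J₀(N)` (the modular degree is the fibre count `D.modularDegree` of a
datum `D : ModularParametrizationData W N`, `ModularCurve.lean`), so Lemma 5.6 is out of reach;
its arithmetic content for `X₀(N)` is exactly what the tree records as the named fact
`modularDegree_dvd_congruenceNumber` (`CongruenceNumber.lean`; Ribet's theorem `m_E ∣ r_E`,
Agashe–Ribet–Stein 2012, Thm. 2.1, with `r_E = r_f = #(S₂(Γ₀(N); ℤ)/(ℤf + (ℤf)^⊥))` the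
congruence number; reduced to the strong Weil curve in `CongruenceNumberRibetProofs.lean`).
This file proves **everything else** of the second proof over the Hecke-ring interface of
`HeckeCongruenceModulus.lean` (`𝕋 = anemicHeckeRing N k`, `𝕀_{[χ₀]} = eigenIdeal f`,
`η = heckeCongruenceModulus f P`, classes `[χ] ≠ [χ₀]` = minimal primes `P ≠ 𝕀_{[χ₀]}` of `𝕋`):

* `anemicHeckeRing.apply_mem_integralCuspForms0` — `𝕋` preserves `S_k(Γ₀(N); ℤ)`
  (`a_n(T_p g) = a_{pn}(g) + p^{k-1} a_{n/p}(g)`, Diamond–Shurman Prop. 5.2.2(a), the tree's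
  `qExpansion_coeff_heckeT_holds`).
* `exists_varpi` — Pasten's `ϖ`: an element of `𝕋` lying in every minimal prime
  `P ≠ 𝕀_{[χ₀]}` with `χ₀(ϖ) = R = ∏_{P ≠ 𝕀_{[χ₀]}} η_{[χ₀]}(P)` (`t_P ∈ P` with `χ₀(t_P) = η(P)`
  exists because `η(P) = [ℤ : χ₀(P)]` generates `χ₀(P) ⊆ ℤ`, `heckeCongruenceModulus_eq_absNorm`).
* `exists_apply_eq_smul_of_forall_mem_minimalPrimes` — **`ϖ = χ₀(ϖ) · π₀`**: for every
  `g ∈ S_k(Γ₀(N))`, `ϖ g = μ f` with `μ ⟨f, f⟩ = χ₀(ϖ) ⟨f, g⟩`. Here Pasten's "the action of `𝕋`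
  on `V` is simultaneously diagonalizable" (§4.9) is the decomposition of the finite-dimensional
  `S_k(Γ₀(N))` (`finiteDimensional_cuspForm_gamma0`) into the joint eigenspaces of the commuting
  (`heckeT_comm_gamma0_holds`), Petersson self-adjoint (`heckeT_selfAdjoint_holds`,
  Diamond–Shurman Thm. 5.5.3; `maxGenEigenspace_eq_eigenspace_of_selfAdjoint`) family
  `(T_p)_{p ∤ N}`; "`dim V^{χ₀} = 1`" (§4.9, multiplicity one) is
  `mem_span_of_equiv_of_mem_newSubspace0` (Atkin–Lehner; Knapp Thm. 9.22, proved in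
  `NewformsMultiplicityOneProofs.lean`); the orthogonality of `V^χ ⊥ V^{χ₀}` (§4.9) is
  self-adjointness at a separating `T_p` (the eigenvalue of `f` being a rational integer); and
  `ϖ V^χ = 0` for `[χ] ≠ [χ₀]` is `ϖ ∈ 𝕀_{[χ]}` with `𝕀_{[χ]} = eigenIdeal u` a minimal prime
  (`eigenIdeal_mem_minimalPrimes`) different from `𝕀_{[χ₀]}` (`T_p - a_p(f) ∈ 𝕀_{[χ₀]}` does not
  kill `u`).
* `congruenceNumber_dvd_prod_heckeCongruenceModulus` — **`r_f ∣ ∏_{P ≠ 𝕀_{[χ₀]}} η_{[χ₀]}(P)`**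
  for a newform `f` with integral coefficients: for `g ∈ S_k(Γ₀(N); ℤ)`, `ϖ g = (R⟨f,g⟩/⟨f,f⟩) f`
  is integral, so `R⟨f,g⟩/⟨f,f⟩ = a₁(ϖ g) ∈ ℤ` (`a₁(f) = 1`); the additive map
  `g ↦ R⟨f,g⟩/⟨f,f⟩ mod R`, `S_k(Γ₀(N); ℤ) → ℤ/Rℤ`, has kernel `ℤf + (ℤf)^⊥`
  (`mem_span_sup_integralOrthogonal0_iff`), so `S_k(Γ₀(N); ℤ)/(ℤf + (ℤf)^⊥) ↪ ℤ/Rℤ` and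
  `r_f ∣ R` (Lagrange). This is the Hecke-ring shadow of Lemma 5.6: `m π₀` preserves
  `S₂(Γ₀(N); ℤ)` iff `r_f ∣ m`.
* `ModularParametrizationData.congruenceNumber_dvd_prod_heckeCongruenceModulus` — the case of
  the newform `D.f` of an elliptic curve (`IsNewformOf`: a newform with coefficients `aₙ(W) ∈ ℤ`).
* `PastenShimura2024_thm_5_5_of_modularDegree_dvd_congruenceNumber` — **the reduction**:
  `modularDegree_dvd_congruenceNumber → PastenShimura2024_thm_5_5`
  (`δ_{1,N} = D.modularDegree ∣ r_{D.f} ∣ ∏ η`; the two facts carry the same minimal-degree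
  hypothesis on `D`). So `PastenShimura2024_thm_5_5_holds` follows in one line once Ribet's
  theorem is discharged; nothing else is missing.

Not used: Pasten's first proof (§5.5, torsion points `Q_j ∈ B₀[δ]` of abelian subvarieties of
`J₀^D(M)`), equally out of reach without Jacobians. Nothing is discharged unconditionally; no
statement of the tree is changed; no definition and no named fact is added.

## References

* H. Pasten, *Shimura curves and the abc conjecture*, J. Number Theory 254 (2024), 214–335,
  doi:10.1016/j.jnt.2023.07.002 = arXiv:1705.09251: §4.9–4.11 (p. 16), §5.4 and Prop. 5.4
  (p. 17), Thm. 5.5 (p. 18), §5.6 with Lemma 5.6 (p. 19). [PastenShimura2024]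
* A. Agashe, K. A. Ribet, W. A. Stein, *The modular degree, congruence primes, and multiplicity
  one*, in: Number Theory, Analysis and Geometry (in memory of S. Lang), Springer 2012, 19–49,
  doi:10.1007/978-1-4614-1260-1_2: §2.1, Thm. 2.1. [AgasheRibetStein2012]
* F. Diamond, J. Shurman, *A first course in modular forms*, GTM 228, Springer 2005:
  Prop. 5.2.2(a), Thm. 5.5.3, Cor. 5.6.3. [DiamondShurman2005]
* A. W. Knapp, *Elliptic curves*, Math. Notes 40, Princeton 1993: Thm. 9.22 (§IX.7).
  [Knapp1993]
-/

noncomputable section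

open scoped MatrixGroups ModularForm ComplexConjugate

open CongruenceSubgroup UpperHalfPlane

namespace Literature.NumberTheory.EllipticCurves.ModularForms

/-! ### The Hecke ring preserves the integral forms `S_k(Γ₀(N); ℤ)` -/

section Integral

variable {N : ℕ} [NeZero N] {k : ℤ}

/-- `T_p`, `p ∤ N` prime, preserves `S_k(Γ₀(N); ℤ)`: `a_n(T_p g) = a_{pn}(g) + p^{k-1} a_{n/p}(g)`
(Diamond–Shurman Prop. 5.2.2(a), the tree's `qExpansion_coeff_heckeT_holds`; for `k ≤ 0` the
space is `0`). [cite: DiamondShurman2005, Prop. 5.2.2(a)] -/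
theorem heckeT_mem_integralCuspForms0 (p : ℕ) [NeZero p] (hp : p.Prime) (hpN : ¬ p ∣ N)
    {g : CuspForm (Gamma0 N) k} (hg : g ∈ integralCuspForms0 N k) :
    heckeT (Gamma0 N) k p g ∈ integralCuspForms0 N k := by
  rcases le_or_gt 1 k with hk | hk
  · intro n
    change ∃ z : ℤ, (z : ℂ) = (qExpansion 1 ⇑(heckeT (Gamma0 N) k p g)).coeff n
    rw [qExpansion_coeff_heckeT_holds N k g p hp n, if_neg hpN]
    obtain ⟨z₁, hz₁⟩ := hg (p * n)
    obtain ⟨z₂, hz₂⟩ := hg (n / p)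
    change (z₁ : ℂ) = (qExpansion 1 ⇑g).coeff (p * n) at hz₁
    change (z₂ : ℂ) = (qExpansion 1 ⇑g).coeff (n / p) at hz₂
    have hpow : ((p : ℂ) ^ (k - 1)) = ((p ^ (k - 1).toNat : ℕ) : ℂ) := by
      rw [Nat.cast_pow, ← zpow_natCast, Int.toNat_of_nonneg (by omega)]
    rw [← hz₁, hpow]
    by_cases hpn : p ∣ n
    · rw [if_pos hpn, ← hz₂]
      exact ⟨z₁ + (p ^ (k - 1).toNat : ℕ) * z₂, by push_cast; ring⟩
    · rw [if_neg hpn, mul_zero, add_zero]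
      exact ⟨z₁, rfl⟩
  · have h0 : heckeT (Gamma0 N) k p g = 0 := cuspForm_eq_zero_of_weight_nonpos (by omega) _
    rw [h0]
    exact Submodule.zero_mem _

/-- Every element of `𝕋 = ℤ[T_p : p ∤ N]` preserves `S_k(Γ₀(N); ℤ)`. [folklore] -/
theorem anemicHeckeRing.apply_mem_integralCuspForms0 (t : anemicHeckeRing N k)
    {g : CuspForm (Gamma0 N) k} (hg : g ∈ integralCuspForms0 N k) :
    (t : Module.End ℂ (CuspForm (Gamma0 N) k)) g ∈ integralCuspForms0 N k := by
  obtain ⟨t, ht⟩ := t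
  change t g ∈ integralCuspForms0 N k
  induction ht using Algebra.adjoin_induction generalizing g with
  | mem x hx =>
    obtain ⟨p, hp, hpN, rfl⟩ := hx
    haveI : NeZero p := ⟨hp.ne_zero⟩
    exact heckeT_mem_integralCuspForms0 p hp hpN hg
  | algebraMap r =>
    have h : (algebraMap ℤ (Module.End ℂ (CuspForm (Gamma0 N) k)) r) g = ((r : ℤ) : ℂ) • g := by
      rw [Algebra.algebraMap_eq_smul_one, LinearMap.smul_apply, Module.End.one_apply,
        Int.cast_smul_eq_zsmul]
    rw [h, Int.cast_smul_eq_zsmul]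
    exact (integralCuspForms0 N k).smul_mem r hg
  | add x y _ _ hx hy =>
    rw [LinearMap.add_apply]
    exact add_mem (hx hg) (hy hg)
  | mul x y _ _ hx hy =>
    rw [Module.End.mul_apply]
    exact hx (hy hg)

end Integral

/-! ### Pasten's element `ϖ = ∏_{c ≠ [χ₀]} t_c` (second proof of Thm. 5.5, §5.6) -/

section Varpi

variable {N : ℕ} [NeZero N] {k : ℤ}

/-- For `f ≠ 0` with `ℤ`-valued system `χ₀` and any ideal `P` of `𝕋` there is `t ∈ P` with
`χ₀(t) = η_{[χ₀]}(P)` (Pasten 2024, §5.6: "choose an element `t_{c'} ∈ 𝕀_{c'}` such that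
`t_{c'} · f = η_{[χ₀]}(c') · f`"): `η = [ℤ : χ₀(P)]` generates the ideal `χ₀(P)` of `ℤ`.
[cite: PastenShimura2024, §5.6 p. 19] -/
theorem exists_mem_intEigencharacter_eq_heckeCongruenceModulus {f : CuspForm (Gamma0 N) k}
    (hf : HasIntegralEigenvalues f) (hf0 : f ≠ 0) (P : Ideal (anemicHeckeRing N k)) :
    ∃ t ∈ P, intEigencharacter hf hf0 t = heckeCongruenceModulus f P := by
  have hmem : ((heckeCongruenceModulus f P : ℕ) : ℤ) ∈ P.map (intEigencharacter hf hf0) := by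
    rw [heckeCongruenceModulus_eq_absNorm hf hf0 P]
    exact Ideal.absNorm_mem _
  obtain ⟨t, ht, hteq⟩ := (Ideal.mem_map_iff_of_surjective _
    (surjective_of_ringHom_int (intEigencharacter hf hf0))).mp hmem
  exact ⟨t, ht, hteq⟩

/-- **Pasten's `ϖ`** (2024, second proof of Thm. 5.5, §5.6 p. 19: "let `ϖ = ∏_{c ≠ [χ₀]} t_c ∈
𝕋_{D,M}`"): for `f ≠ 0` with `ℤ`-valued system `χ₀` there is `ϖ ∈ 𝕋` lying in every minimal prime
`P ≠ 𝕀_{[χ₀]}` of `𝕋` and with `χ₀(ϖ) = ∏_{P ≠ 𝕀_{[χ₀]}} η_{[χ₀]}(P)`.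
[cite: PastenShimura2024, §5.6 p. 19] -/
theorem exists_varpi {f : CuspForm (Gamma0 N) k} (hf : HasIntegralEigenvalues f) (hf0 : f ≠ 0) :
    ∃ ϖ : anemicHeckeRing N k,
      (∀ P ∈ minimalPrimes (anemicHeckeRing N k), P ≠ eigenIdeal f → ϖ ∈ P) ∧
      intEigencharacter hf hf0 ϖ =
        ((∏ P ∈ ((finite_minimalPrimes_anemicHeckeRing N k).toFinset.erase (eigenIdeal f)),
          heckeCongruenceModulus f P : ℕ) : ℤ) := by
  classical
  choose t ht hteq using exists_mem_intEigencharacter_eq_heckeCongruenceModulus hf hf0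
  set s := (finite_minimalPrimes_anemicHeckeRing N k).toFinset.erase (eigenIdeal f) with hs
  refine ⟨∏ P ∈ s, t P, fun P hP hne ↦ ?_, ?_⟩
  · have hPs : P ∈ s := by
      rw [hs, Finset.mem_erase]
      exact ⟨hne, (finite_minimalPrimes_anemicHeckeRing N k).mem_toFinset.mpr hP⟩
    obtain ⟨c, hc⟩ := Finset.dvd_prod_of_mem t hPs
    rw [hc]
    exact P.mul_mem_right c (ht P)
  · rw [map_prod, Nat.cast_prod]
    exact Finset.prod_congr rfl fun P _ ↦ hteq P

end Varpi

/-! ### `ϖ` acts on `S_k(Γ₀(N))` as `χ₀(ϖ) · π₀` (Pasten 2024, §5.6) -/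

section Projector

variable {N : ℕ} [NeZero N] {k : ℤ}

/-- **`ϖ = χ₀(ϖ) · π₀` on `S_k(Γ₀(N))`** (Pasten 2024, second proof of Thm. 5.5, §5.6 p. 19:
"`ψ(ϖ)` has the integer `∏_{c ≠ [χ₀]} η_{[χ₀]}(c)` in the `[χ₀]`-component, and `0` in all other
components. It follows that `ϖ = (∏_{c ≠ [χ₀]} η_{[χ₀]}(c)) π₀`", `π₀` the Petersson-orthogonal
projection onto `V^{χ₀} = ℂ f`). Precisely: let `f ≠ 0` lie in the new subspace and have a
`ℤ`-valued system of eigenvalues `χ₀` on `𝕋 = ℤ[T_p : p ∤ N]`, and let `ϖ ∈ 𝕋` lie in every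
minimal prime `P ≠ 𝕀_{[χ₀]}` of `𝕋`. Then for every `g ∈ S_k(Γ₀(N))`, `ϖ g = μ f` with
`μ ⟨f, f⟩ = χ₀(ϖ) ⟨f, g⟩`. Proof: `S_k(Γ₀(N))` (finite-dimensional, `finiteDimensional_cuspForm_gamma0`)
is the sum of the joint eigenspaces of the commuting (`heckeT_comm_gamma0_holds`), Petersson
self-adjoint (`heckeT_selfAdjoint_holds`, Diamond–Shurman Thm. 5.5.3) family `(T_p)_{p ∤ N}`
(Pasten §4.9: "simultaneously diagonalizable"); a joint eigenvector `u ≠ 0` with the eigenvalues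
of `f` is a multiple of `f` (multiplicity one, `mem_span_of_equiv_of_mem_newSubspace0`, Knapp
Thm. 9.22), on which `ϖ` acts by `χ₀(ϖ)`; a joint eigenvector `u` with another system is
orthogonal to `f` (self-adjointness at a separating `T_p`, the eigenvalue of `f` being a rational
integer) and is killed by `ϖ`, because its eigen-ideal is a minimal prime of `𝕋`
(`eigenIdeal_mem_minimalPrimes`) other than `𝕀_{[χ₀]}` (the element `T_p - a_p(f) ∈ 𝕀_{[χ₀]}`
does not kill `u`). [cite: PastenShimura2024, §5.6 p. 19 (second proof of Thm. 5.5)]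
[cite: Knapp1993, Thm. 9.22 (§IX.7, p. 283)] -/
theorem exists_apply_eq_smul_of_forall_mem_minimalPrimes {f : CuspForm (Gamma0 N) k}
    (hf : HasIntegralEigenvalues f) (hf0 : f ≠ 0) (hfnew : f ∈ newSubspace0 N k)
    {ϖ : anemicHeckeRing N k}
    (hϖ : ∀ P ∈ minimalPrimes (anemicHeckeRing N k), P ≠ eigenIdeal f → ϖ ∈ P)
    (g : CuspForm (Gamma0 N) k) :
    ∃ μ : ℂ, (ϖ : Module.End ℂ (CuspForm (Gamma0 N) k)) g = μ • f ∧
      μ * peterssonProduct (Gamma0 N) k f f =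
        (intEigencharacter hf hf0 ϖ : ℂ) * peterssonProduct (Gamma0 N) k f g := by
  haveI : FiniteDimensional ℂ (CuspForm (Gamma0 N) k) := finiteDimensional_cuspForm_gamma0 N k
  -- the primes away from the level and their Hecke operators
  let P : Type := {p : Nat.Primes // ¬ ((p : ℕ) ∣ N)}
  haveI hP0 : ∀ p : P, NeZero ((p.1 : ℕ)) := fun p ↦ ⟨p.1.2.ne_zero⟩
  let T : P → Module.End ℂ (CuspForm (Gamma0 N) k) := fun p ↦ heckeT (Gamma0 N) k (p.1 : ℕ)
  have hT : ∀ p : P, T p = heckeT (Gamma0 N) k (p.1 : ℕ) := fun p ↦ rfl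
  have hcomm : Pairwise fun p q ↦ Commute (T p) (T q) := fun p q _ ↦
    heckeT_comm_gamma0_holds N k (p.1 : ℕ) (q.1 : ℕ)
  have htop : ⨆ χ : P → ℂ, ⨅ p, (T p).maxGenEigenspace (χ p) = ⊤ :=
    Module.End.iSup_iInf_maxGenEigenspace_eq_top_of_iSup_maxGenEigenspace_eq_top_of_commute T hcomm
      fun p ↦ Module.End.iSup_maxGenEigenspace_eq_top (T p)
  -- generalised eigenspaces of the self-adjoint `T_p` are eigenspaces
  have hgen : ∀ (p : P) (μ : ℂ), (T p).maxGenEigenspace μ = (T p).eigenspace μ := fun p μ ↦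
    maxGenEigenspace_eq_eigenspace_of_selfAdjoint (peterssonProduct (Gamma0 N) k)
      (peterssonProduct_add_right k) (peterssonProduct_smul_right (Gamma0 N) k)
      (fun v w ↦ peterssonProduct_conj_symm_holds (Gamma0 N) k v w)
      (eq_zero_of_peterssonProduct_self_eq_zero k) (T p)
      (fun v w ↦ by rw [hT]; exact heckeT_selfAdjoint_holds N k (p.1 : ℕ) p.1.2 p.2 v w) μ
  set χ₀ := intEigencharacter hf hf0 with hχ₀
  set c := peterssonProduct (Gamma0 N) k f f with hc
  -- `ϖ f = χ₀(ϖ) f`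
  have hϖf : (ϖ : Module.End ℂ (CuspForm (Gamma0 N) k)) f = (χ₀ ϖ : ℂ) • f :=
    intEigencharacter_spec hf hf0 ϖ
  -- `T_p f = a_p(f) f` for `p ∤ N`, with `a_p(f) ∈ ℤ`
  have hfT : ∀ (p : ℕ) (hp : p.Prime), ¬ p ∣ N →
      (haveI : NeZero p := ⟨hp.ne_zero⟩; heckeT (Gamma0 N) k p f) = heckeEigenvalue f p • f := by
    intro p hp hpN
    haveI : NeZero p := ⟨hp.ne_zero⟩
    obtain ⟨a, ha⟩ := hf p hp hpN
    exact heckeT_eq_heckeEigenvalue_smul f p ⟨a, ha⟩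
  have hint : ∀ (p : ℕ) (hp : p.Prime), ¬ p ∣ N → ∃ n : ℤ, heckeEigenvalue f p = n := by
    intro p hp hpN
    haveI : NeZero p := ⟨hp.ne_zero⟩
    obtain ⟨n, hn⟩ := hf p hp hpN
    exact ⟨n, smul_left_injective ℂ hf0 ((hfT p hp hpN).symm.trans hn)⟩
  -- induction over the joint eigenspace decomposition of `S_k(Γ₀(N))`
  have hg : g ∈ ⨆ χ : P → ℂ, ⨅ p, (T p).maxGenEigenspace (χ p) := by
    rw [htop]
    exact Submodule.mem_top
  refine Submodule.iSup_induction (fun χ : P → ℂ ↦ ⨅ p, (T p).maxGenEigenspace (χ p))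
    (motive := fun u ↦ ∃ μ : ℂ, (ϖ : Module.End ℂ (CuspForm (Gamma0 N) k)) u = μ • f ∧
      μ * c = (χ₀ ϖ : ℂ) * peterssonProduct (Gamma0 N) k f u) hg ?_ ?_ ?_
  · -- a joint eigenvector `u` with character `χ`
    intro χ u hu
    have huT : ∀ p : P, T p u = χ p • u := fun p ↦ by
      have h := (Submodule.mem_iInf _).mp hu p
      rwa [hgen, Module.End.mem_eigenspace_iff] at h
    by_cases hu0 : u = 0
    · refine ⟨0, ?_, ?_⟩
      · rw [hu0, map_zero, zero_smul]
      · rw [hu0, peterssonProduct_zero_right, zero_mul, mul_zero]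
    by_cases hall : ∀ p : P, χ p = heckeEigenvalue f (p.1 : ℕ)
    · -- the system of eigenvalues of `f`: `u ∈ ℂ f` by multiplicity one
      have hu' : ∀ (p : ℕ) (hp : p.Prime), ¬ p ∣ N →
          (haveI : NeZero p := ⟨hp.ne_zero⟩; heckeT (Gamma0 N) k p u) =
            heckeEigenvalue f p • u := by
        intro p hp hpN
        have h := huT ⟨⟨p, hp⟩, hpN⟩
        rw [hall, hT] at h
        exact h
      obtain ⟨a, rfl⟩ := Submodule.mem_span_singleton.mp
        (mem_span_of_equiv_of_mem_newSubspace0 (a := fun p ↦ heckeEigenvalue f p) hf0 hfnew hfT u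
          hu')
      refine ⟨a * (χ₀ ϖ : ℂ), ?_, ?_⟩
      · rw [map_smul, hϖf, smul_smul]
      · rw [peterssonProduct_smul_right, hc]
        ring
    · -- another system of eigenvalues: `u ⊥ f` and `ϖ u = 0`
      push Not at hall
      obtain ⟨p, hp⟩ := hall
      obtain ⟨n, hn⟩ := hint p.1 p.1.2 p.2
      have hTf : T p f = (n : ℂ) • f := by
        have h := hfT p.1 p.1.2 p.2
        rw [hn] at h
        rw [hT]
        exact h
      -- orthogonality, by self-adjointness of `T_p` and reality of `a_p(f)`
      have horth : peterssonProduct (Gamma0 N) k f u = 0 := by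
        have h : peterssonProduct (Gamma0 N) k (T p f) u =
            peterssonProduct (Gamma0 N) k f (T p u) := by
          rw [hT]
          exact heckeT_selfAdjoint_holds N k (p.1 : ℕ) p.1.2 p.2 f u
        rw [hTf, huT p, peterssonProduct_smul_left, peterssonProduct_smul_right, map_intCast] at h
        have hne : (n : ℂ) - χ p ≠ 0 := by
          rw [sub_ne_zero, ← hn]
          exact fun h' ↦ hp h'.symm
        have h' : ((n : ℂ) - χ p) * peterssonProduct (Gamma0 N) k f u = 0 := by
          rw [sub_mul, h, sub_self]
        exact (mul_eq_zero.mp h').resolve_left hne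
      -- the eigen-ideal of `u` is a minimal prime other than `𝕀_{[χ₀]}`, so contains `ϖ`
      have huA : IsAnemicEigenvector u := fun q hq hqN ↦ ⟨χ ⟨⟨q, hq⟩, hqN⟩, huT ⟨⟨q, hq⟩, hqN⟩⟩
      have hne : eigenIdeal u ≠ eigenIdeal f := by
        intro heq
        set t : anemicHeckeRing N k :=
          anemicHeckeRing.T N k (p.1 : ℕ) p.1.2 p.2 - algebraMap ℤ (anemicHeckeRing N k) n with ht
        have htapply : ∀ v : CuspForm (Gamma0 N) k,
            (t : Module.End ℂ (CuspForm (Gamma0 N) k)) v = T p v - (n : ℂ) • v := by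
          intro v
          rw [ht, Subalgebra.coe_sub, LinearMap.sub_apply, anemicHeckeRing.coe_T,
            Subalgebra.coe_algebraMap, Algebra.algebraMap_eq_smul_one, LinearMap.smul_apply,
            Module.End.one_apply, Int.cast_smul_eq_zsmul]
        have htf : t ∈ eigenIdeal f := by
          rw [mem_eigenIdeal, htapply, hTf, sub_self]
        rw [← heq, mem_eigenIdeal, htapply, huT p, sub_eq_zero] at htf
        exact hp (by rw [hn]; exact smul_left_injective ℂ hu0 htf)
      have hmin : eigenIdeal u ∈ minimalPrimes (anemicHeckeRing N k) :=
        eigenIdeal_mem_minimalPrimes huA hu0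
      have hϖu : (ϖ : Module.End ℂ (CuspForm (Gamma0 N) k)) u = 0 :=
        mem_eigenIdeal.mp (hϖ _ hmin hne)
      refine ⟨0, ?_, ?_⟩
      · rw [hϖu, zero_smul]
      · rw [horth, zero_mul, mul_zero]
  · exact ⟨0, by rw [map_zero, zero_smul], by rw [peterssonProduct_zero_right, zero_mul, mul_zero]⟩
  · rintro x y ⟨μ, hμ, hμc⟩ ⟨ν, hν, hνc⟩
    refine ⟨μ + ν, ?_, ?_⟩
    · rw [map_add, hμ, hν, add_smul]
    · rw [add_mul, hμc, hνc, peterssonProduct_add_right, mul_add]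

end Projector

/-! ### The congruence number divides `∏_{P ≠ 𝕀_{[χ₀]}} η_{[χ₀]}(P)` -/

section Counting

variable {N : ℕ} [NeZero N] {k : ℤ}

/-- Membership in `ℤf + (ℤf)^⊥` for an integral form `g`, read off the Petersson product:
`g ∈ ℤf + (ℤf)^⊥ ↔ ⟨f, g⟩ ∈ ℤ ⟨f, f⟩` (for `f ∈ S_k(Γ₀(N); ℤ)`; ARS 2012, §2.1, the mechanism
behind "(i) ⇔ (ii)"). [cite: AgasheRibetStein2012, §2.1] -/
theorem mem_span_sup_integralOrthogonal0_iff {f : CuspForm (Gamma0 N) k}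
    (hfL : f ∈ integralCuspForms0 N k) {g : CuspForm (Gamma0 N) k}
    (hg : g ∈ integralCuspForms0 N k) :
    g ∈ (ℤ ∙ f) ⊔ integralOrthogonal0 f ↔
      ∃ m : ℤ, peterssonProduct (Gamma0 N) k f g = m * peterssonProduct (Gamma0 N) k f f := by
  have hmf : ∀ m : ℤ, peterssonProduct (Gamma0 N) k f (m • f) =
      m * peterssonProduct (Gamma0 N) k f f := fun m ↦ by
    rw [← Int.cast_smul_eq_zsmul ℂ, peterssonProduct_smul_right]
  constructor
  · intro h
    obtain ⟨y, hy, z, hz, rfl⟩ := Submodule.mem_sup.mp h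
    obtain ⟨m, rfl⟩ := Submodule.mem_span_singleton.mp hy
    refine ⟨m, ?_⟩
    rw [peterssonProduct_add_right, (mem_integralOrthogonal0.mp hz).2, add_zero, hmf]
  · rintro ⟨m, hm⟩
    have hz : g - m • f ∈ integralOrthogonal0 f := by
      rw [mem_integralOrthogonal0]
      refine ⟨sub_mem hg ((integralCuspForms0 N k).smul_mem m hfL), ?_⟩
      have h := peterssonProduct_add_right k f (g - m • f) (m • f)
      rw [sub_add_cancel, hm, hmf] at h
      linear_combination -h
    have hg' : g = m • f + (g - m • f) := by abel
    rw [hg']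
    exact Submodule.add_mem_sup (Submodule.smul_mem _ _ (Submodule.mem_span_singleton_self f)) hz

/-- **The congruence number divides the product of the congruence moduli.** For a newform
`f ∈ S_k(Γ₀(N))` with integral Fourier coefficients (so with a `ℤ`-valued system of Hecke
eigenvalues `χ₀` on `𝕋 = ℤ[T_p : p ∤ N]`), the congruence number
`r_f = #(S_k(Γ₀(N); ℤ) / (ℤf + (ℤf)^⊥))` of Agashe–Ribet–Stein (2012, §2.1; `congruenceNumber`)
divides `∏_{P ≠ 𝕀_{[χ₀]}} η_{[χ₀]}(P)`, the product of Pasten's congruence moduli over the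
minimal primes `P ≠ 𝕀_{[χ₀]}` of `𝕋` (Pasten 2024, Thm. 5.5's right-hand side). This is the
`X₀(N)`-case of Pasten's second proof of Thm. 5.5 (§5.6, p. 19) with Lemma 5.6 (the modular
degree `δ` is the denominator of the projector `π₀` with respect to `End(J₀(N))`, [CoKa],
[ARSdeg]) replaced by its Hecke-ring shadow: with `R = ∏ η` and Pasten's `ϖ = R π₀ ∈ 𝕋`
(`exists_varpi`, `exists_apply_eq_smul_of_forall_mem_minimalPrimes`), for every
`g ∈ S_k(Γ₀(N); ℤ)` the form `ϖ g = (R⟨f, g⟩/⟨f, f⟩) f` is again integral (`𝕋` preserves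
`S_k(Γ₀(N); ℤ)`, `anemicHeckeRing.apply_mem_integralCuspForms0`), so `R⟨f, g⟩/⟨f, f⟩ = a₁(ϖ g) ∈ ℤ`
(`a₁(f) = 1`); hence `g ↦ R⟨f, g⟩/⟨f, f⟩ mod R` is an additive map `S_k(Γ₀(N); ℤ) → ℤ/Rℤ` whose
kernel is exactly `ℤf + (ℤf)^⊥` (`mem_span_sup_integralOrthogonal0_iff`), and
`S_k(Γ₀(N); ℤ)/(ℤf + (ℤf)^⊥)` embeds in the cyclic group `ℤ/Rℤ`. Combined with Ribet's theorem
`δ = m_E ∣ r_f` (ARS 2012, Thm. 2.1; the tree's named fact `modularDegree_dvd_congruenceNumber`)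
this gives Pasten's Thm. 5.5 for `X₀(N)`
(`PastenShimura2024_thm_5_5_of_modularDegree_dvd_congruenceNumber`).
[cite: PastenShimura2024, §5.6 p. 19 (second proof of Thm. 5.5)]
[cite: AgasheRibetStein2012, §2.1] -/
theorem congruenceNumber_dvd_prod_heckeCongruenceModulus {f : CuspForm (Gamma0 N) k}
    (hnew : IsNewform0 f) (hf : HasIntegralEigenvalues f) (hfL : f ∈ integralCuspForms0 N k) :
    congruenceNumber f ∣
      ∏ P ∈ ((finite_minimalPrimes_anemicHeckeRing N k).toFinset.erase (eigenIdeal f)),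
        heckeCongruenceModulus f P := by
  classical
  obtain ⟨hfnew, -, hf1⟩ := hnew
  have hf0 : f ≠ 0 := by
    intro h
    have h1 : (qExpansion 1 ⇑f).coeff 1 = 1 := hf1
    rw [h, CuspForm.coe_zero, UpperHalfPlane.qExpansion_zero, map_zero] at h1
    exact zero_ne_one h1
  set R : ℕ := ∏ P ∈ ((finite_minimalPrimes_anemicHeckeRing N k).toFinset.erase (eigenIdeal f)),
    heckeCongruenceModulus f P with hR
  have hR0 : R ≠ 0 := by
    rw [hR, Finset.prod_ne_zero_iff]
    intro P hP
    exact heckeCongruenceModulus_ne_zero hf hf0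
      ((finite_minimalPrimes_anemicHeckeRing N k).mem_toFinset.mp (Finset.mem_of_mem_erase hP))
      (Finset.ne_of_mem_erase hP)
  set c : ℂ := peterssonProduct (Gamma0 N) k f f with hc
  have hc0 : c ≠ 0 := fun h0 ↦ hf0 (eq_zero_of_peterssonProduct_self_eq_zero k f h0)
  obtain ⟨ϖ, hϖP, hϖχ⟩ := exists_varpi hf hf0
  rw [← hR] at hϖχ
  set L := integralCuspForms0 N k with hL
  -- Step 1: for `g ∈ S_k(Γ₀(N); ℤ)`, `R ⟨f, g⟩ / ⟨f, f⟩ = a₁(ϖ g)` is an integer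
  have key : ∀ g ∈ L, ∃ m : ℤ, (m : ℂ) * c = (R : ℂ) * peterssonProduct (Gamma0 N) k f g := by
    intro g hg
    obtain ⟨μ, hμ, hμc⟩ := exists_apply_eq_smul_of_forall_mem_minimalPrimes hf hf0 hfnew hϖP g
    rw [hϖχ, Int.cast_natCast] at hμc
    obtain ⟨m, hm⟩ := (anemicHeckeRing.apply_mem_integralCuspForms0 ϖ hg) 1
    have hm' : (m : ℂ) = μ := by
      rw [hm, cuspCoeff, hμ, qExpansion_coeff_smul, show (qExpansion 1 ⇑f).coeff 1 = 1 from hf1,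
        mul_one]
    exact ⟨m, by rw [hm', hμc]⟩
  choose! n hn using key
  -- Step 2: the additive map `S_k(Γ₀(N); ℤ) → ℤ/Rℤ`, `g ↦ R⟨f, g⟩/⟨f, f⟩ mod R`
  have hadd : ∀ g ∈ L, ∀ h ∈ L, n (g + h) = n g + n h := by
    intro g hg h hh
    have e : ((n (g + h) : ℤ) : ℂ) * c = ((n g + n h : ℤ) : ℂ) * c := by
      rw [hn _ (add_mem hg hh), peterssonProduct_add_right, mul_add, ← hn g hg, ← hn h hh,
        Int.cast_add, add_mul]
    exact_mod_cast mul_right_cancel₀ hc0 e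
  let φ : L →+ ZMod R := AddMonoidHom.mk' (fun g ↦ ((n g : ℤ) : ZMod R)) fun g h ↦ by
    change ((n ((g : CuspForm (Gamma0 N) k) + h) : ℤ) : ZMod R) = _
    rw [hadd _ g.2 _ h.2, Int.cast_add]
  have hφ : ∀ g : L, φ g = ((n g : ℤ) : ZMod R) := fun g ↦ rfl
  -- Step 3: its kernel is `ℤf + (ℤf)^⊥`
  set H : Submodule ℤ L := ((ℤ ∙ f) ⊔ integralOrthogonal0 f).comap L.subtype with hH
  have hker : φ.ker = H.toAddSubgroup := by
    ext g
    rw [AddMonoidHom.mem_ker, Submodule.mem_toAddSubgroup, hH, Submodule.mem_comap,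
      Submodule.subtype_apply, mem_span_sup_integralOrthogonal0_iff hfL g.2, hφ,
      ZMod.intCast_zmod_eq_zero_iff_dvd]
    constructor
    · rintro ⟨m, hm⟩
      refine ⟨m, ?_⟩
      have e := hn g g.2
      rw [hm, Int.cast_mul, Int.cast_natCast, mul_assoc] at e
      exact (mul_left_cancel₀ (Nat.cast_ne_zero.mpr hR0) e).symm
    · rintro ⟨m, hm⟩
      refine ⟨m, ?_⟩
      have e : ((n g : ℤ) : ℂ) * c = (((R : ℤ) * m : ℤ) : ℂ) * c := by
        rw [hn g g.2, hm, Int.cast_mul, Int.cast_natCast, mul_assoc]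
      exact_mod_cast mul_right_cancel₀ hc0 e
  -- Step 4: `S_k(Γ₀(N); ℤ)/(ℤf + (ℤf)^⊥)` embeds in `ℤ/Rℤ`
  have hinj : Function.Injective
      ((QuotientAddGroup.kerLift φ).comp
        (QuotientAddGroup.quotientAddEquivOfEq hker.symm).toAddMonoidHom) :=
    (QuotientAddGroup.kerLift_injective φ).comp
      (QuotientAddGroup.quotientAddEquivOfEq hker.symm).injective
  have hdvd := AddSubgroup.card_dvd_of_injective _ hinj
  rw [Nat.card_zmod] at hdvd
  exact hdvd

/-- **`r_f ∣ ∏_{P ≠ 𝕀_{[χ₀]}} η_{[χ₀]}(P)` for the newform of an elliptic curve**: the case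
`f = D.f` of `congruenceNumber_dvd_prod_heckeCongruenceModulus` (`D.f` is a newform with integer
coefficients `aₙ(W)`). [cite: PastenShimura2024, §5.6 p. 19 (second proof of Thm. 5.5)] -/
theorem ModularParametrizationData.congruenceNumber_dvd_prod_heckeCongruenceModulus
    {W : WeierstrassCurve ℚ} (D : ModularParametrizationData W N) :
    congruenceNumber D.f ∣
      ∏ P ∈ ((finite_minimalPrimes_anemicHeckeRing N 2).toFinset.erase (eigenIdeal D.f)),
        heckeCongruenceModulus D.f P :=
  ModularForms.congruenceNumber_dvd_prod_heckeCongruenceModulus D.isNewformOf.1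
    D.hasIntegralEigenvalues_f D.f_mem_integralCuspForms0

end Counting

/-! ### Pasten's Thm. 5.5 for `X₀(N)` from Ribet's theorem -/

/-- **Pasten 2024, Thm. 5.5 (`D = 1`) follows from Ribet's theorem `m_E ∣ r_E`.** Granted the
tree's named fact `modularDegree_dvd_congruenceNumber` (Agashe–Ribet–Stein 2012, Thm. 2.1: the
modular degree of the optimal curve divides the congruence number `r_f`; this is the `X₀(N)`-case
of Pasten's Lemma 5.6, [CoKa]/[ARSdeg], in the form the tree records it), the named fact
`PastenShimura2024_thm_5_5` holds: `δ_{1,N} = D.modularDegree ∣ r_{D.f}`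
(`modularDegree_dvd_congruenceNumber`, same minimal-degree hypothesis) and
`r_{D.f} ∣ ∏_{P ≠ 𝕀_{[χ₀]}} η_{[χ₀]}(P)`
(`ModularParametrizationData.congruenceNumber_dvd_prod_heckeCongruenceModulus`, proved).
[cite: PastenShimura2024, Thm. 5.5 p. 18 and §5.6 p. 19] [cite: AgasheRibetStein2012, Thm. 2.1] -/
theorem PastenShimura2024_thm_5_5_of_modularDegree_dvd_congruenceNumber
    (h : modularDegree_dvd_congruenceNumber) : PastenShimura2024_thm_5_5 := by
  intro N _ W _ D hmin
  exact (h W N D hmin).trans D.congruenceNumber_dvd_prod_heckeCongruenceModulus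

end Literature.NumberTheory.EllipticCurves.ModularForms

end
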